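import Literature.Analysis.FluidPDE.FluidComputer.ThresholdLevelTableRunW0
import Literature.Analysis.FluidPDE.FluidComputer.ThresholdLevelTableRunW1
import Literature.Analysis.FluidPDE.FluidComputer.ThresholdLevelTableRunW2
import Literature.Analysis.FluidPDE.FluidComputer.ThresholdLevelTableRunW3
import Literature.Analysis.FluidPDE.FluidComputer.ThresholdLevelTableRunW4
import Literature.Analysis.FluidPDE.FluidComputer.ThresholdLevelTableRunW5
import Literature.Analysis.FluidPDE.FluidComputer.ThresholdLevelTableRunW6
import Literature.Analysis.FluidPDE.FluidComputer.ThresholdLevelTableRunW7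
import Literature.Analysis.FluidPDE.FluidComputer.ThresholdLevelCertificate
import HarnessLib

/-!
# Certificate: the transfer stage of the threshold gate, UNIFORMLY over a box of gate data (bp3 gen 13, layer 4: robustness variant)

HONEST FRAMING: low prior, high value-of-information experiment on Tao's machine paradigm; NOT a
claim that NS blows up.

The design-point certificate `designPoint_transfer_reach` (`ThresholdLevelCertificate.lean`)
made uniform: for EVERY gate datum `G = (ε, σ, ν, μ, r, κ, δ)` in the box `GIw` — each coupling
within relative `10⁻³` of the design values `ε₀ = 0.2`, `σ₀ ≈ 3.58·10⁻⁴`, `ν₀ = 480`, `μ₀ = 96`,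
`r₀ ≈ 1.1757·10⁴`, `κ₀ = 4800`, and any forcing defect `0 ≤ δ ≤ 1.001·δ₀`, `δ₀ ≈ 3.58·10⁻⁶` —
every `δ`-approximate orbit of `thresholdCircuit ε σ ν μ r κ` started in the SAME level-`0` entry
box (`Bc0`: carrier `a ∈ [0.96980, 0.97039]`, clock `b ∈ [0.23043, 0.23057]`, trigger
`c = C₀ ≈ 4.08·10⁻⁴`, slaving residual `κ d z − r c a ∈ [−0.1068, −0.0985]`, output
`z ∈ [0.074850, 0.074895]`, energy `∈ [0.99940, 1.00060]`), continuous on `[0, T₃]`,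
`T₃ = T₃t ≈ 0.20705`, satisfies `x s 4 ^ 2 ≥ EoutW = (1107665511110269268/2^60)² ≈ 0.92304` at
some `s ∈ [0, T₃]` (`dataBox_transfer_reach`) — at least `92.25 %` of the entry energy in the
output mode, uniformly on the data box.  Same proof as the design point: the kernel runs
`runW0 … runW31` (`ThresholdLevelTableRunW0 … 7`), `runSteps_append_some`,
`TableD.rowsValid_of_runSteps` (which quantifies over every real `G ∈ GIw`),
`levelTableStage_reach`.  Sorry-free; standard axioms only.

WHAT THIS IS NOT: stage 3 only, of one gate of the `5`-mode truncated circuit with an abstract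
forcing defect; a constant (not yet polynomial-in-anything) robustness margin; not the gate
verdict, not a statement about the averaged or true equations, not evidence for blow-up.
-/

noncomputable section

open Set

namespace Literature.Analysis.FluidPDE.FluidComputer

open Literature.Analysis.FluidPDE.Tao2016AveragedNS

namespace ThresholdLevelTable

/-- The whole data-box table run. [folklore] -/
theorem runW_all : runSteps 60 12 3 GIw RbIt Bc0 stepsT CNt = some Bw32 :=
  runSteps_append_some 60 12 3 GIw RbIt runW0
    (runSteps_append_some 60 12 3 GIw RbIt runW1
    (runSteps_append_some 60 12 3 GIw RbIt runW2
    (runSteps_append_some 60 12 3 GIw RbIt runW3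
    (runSteps_append_some 60 12 3 GIw RbIt runW4
    (runSteps_append_some 60 12 3 GIw RbIt runW5
    (runSteps_append_some 60 12 3 GIw RbIt runW6
    (runSteps_append_some 60 12 3 GIw RbIt runW7
    (runSteps_append_some 60 12 3 GIw RbIt runW8
    (runSteps_append_some 60 12 3 GIw RbIt runW9
    (runSteps_append_some 60 12 3 GIw RbIt runW10
    (runSteps_append_some 60 12 3 GIw RbIt runW11
    (runSteps_append_some 60 12 3 GIw RbIt runW12
    (runSteps_append_some 60 12 3 GIw RbIt runW13
    (runSteps_append_some 60 12 3 GIw RbIt runW14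
    (runSteps_append_some 60 12 3 GIw RbIt runW15
    (runSteps_append_some 60 12 3 GIw RbIt runW16
    (runSteps_append_some 60 12 3 GIw RbIt runW17
    (runSteps_append_some 60 12 3 GIw RbIt runW18
    (runSteps_append_some 60 12 3 GIw RbIt runW19
    (runSteps_append_some 60 12 3 GIw RbIt runW20
    (runSteps_append_some 60 12 3 GIw RbIt runW21
    (runSteps_append_some 60 12 3 GIw RbIt runW22
    (runSteps_append_some 60 12 3 GIw RbIt runW23
    (runSteps_append_some 60 12 3 GIw RbIt runW24
    (runSteps_append_some 60 12 3 GIw RbIt runW25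
    (runSteps_append_some 60 12 3 GIw RbIt runW26
    (runSteps_append_some 60 12 3 GIw RbIt runW27
    (runSteps_append_some 60 12 3 GIw RbIt runW28
    (runSteps_append_some 60 12 3 GIw RbIt runW29
    (runSteps_append_some 60 12 3 GIw RbIt runW30
    (runW31)))))))))))))))))))))))))))))))

/-- The certified output load on the data box, `(zℓ at level 800)² ≈ 0.92304`. [folklore] -/
def EoutW : ℝ := ((1107665511110269268 : ℝ) / 2 ^ 60) ^ 2

/-- Gate data in the box are admissible (signs). [folklore] -/
theorem valid_of_memW {G : GateData} (hG : GIw.Mem 60 G) : G.Valid :=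
  ⟨DI.nonneg_of_nonnegB (I := GIw.ε) (by decide) hG.ε,
    DI.nonneg_of_nonnegB (I := GIw.σ) (by decide) hG.σ,
    DI.nonneg_of_nonnegB (I := GIw.ν) (by decide) hG.ν,
    DI.nonneg_of_nonnegB (I := GIw.μ) (by decide) hG.μ,
    DI.nonneg_of_nonnegB (I := GIw.r) (by decide) hG.r,
    DI.pos_of_posB (I := GIw.κ) (by decide) hG.κ,
    DI.nonneg_of_nonnegB (I := GIw.δ) (by decide) hG.δ⟩

/-- The real level table generated for the data box. [folklore] -/
def LtW : LevelTable := tableT.toTable 60 12 3 GIw RbIt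

/-- Its rows are valid for every gate datum in the box, and the final entry box is `Bw32`.
[folklore] -/
theorem LtW_rowsValid {G : GateData} (hG : GIw.Mem 60 G) :
    LtW.RowsValid G Rbt ∧ tableT.entry 60 12 3 GIw RbIt tableT.steps.length = Bw32 :=
  TableD.rowsValid_of_runSteps (by norm_num) hG RbIt_mem tableT runW_all

/-- The caps of `LtW` sum to `T₃t` (same steps as `Lt`). [folklore] -/
theorem LtW_time : ∑ k ∈ Finset.range LtW.N, LtW.h k = T₃t := Lt_time

/-- The level-`0` entry box and level are those of the design-point table. [folklore] -/
theorem LtW_B_zero : LtW.B 0 = Lt.B 0 ∧ LtW.C 0 = Lt.C 0 := ⟨rfl, rfl⟩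

/-- Energy confinement margin, uniformly in `δ ≤ 1.001 δ₀`. [folklore] -/
theorem LtW_energy {G : GateData} (hG : GIw.Mem 60 G) :
    ∀ q ∈ {q | (LtW.B 0).mem G.κ G.r (LtW.C 0) q}, energy q + 10 * (G.δ * Rbt) * T₃t < Rbt ^ 2 := by
  intro q hq
  have hEh : energy q ≤ ((1153613361157173206 : ℤ) : ℝ) / 2 ^ 60 := hq.2.2.2.2.2.2
  have hδ : G.δ * 2 ^ 60 ≤ ((4128948027313 : ℤ) : ℝ) := hG.δ.2
  have hnum : ((1153613361157173206 : ℤ) : ℝ) / 2 ^ 60 +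
      10 * ((((4128948027313 : ℤ) : ℝ) / 2 ^ 60) * Rbt) * T₃t < Rbt ^ 2 := by
    norm_num [Rbt, T₃t]
  have hRb : (0 : ℝ) < Rbt := by norm_num [Rbt]
  have hT : (0 : ℝ) < T₃t := by norm_num [T₃t]
  have hδ' : G.δ ≤ ((4128948027313 : ℤ) : ℝ) / 2 ^ 60 := by
    rw [le_div_iff₀ (by positivity)]; exact hδ
  have hmono : 10 * (G.δ * Rbt) * T₃t ≤ 10 * ((((4128948027313 : ℤ) : ℝ) / 2 ^ 60) * Rbt) * T₃t := by
    have := mul_le_mul_of_nonneg_right hδ' hRb.le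
    nlinarith
  linarith

/-- The final entry box certifies the output load. [folklore] -/
theorem LtW_exit {G : GateData} (hG : GIw.Mem 60 G) :
    ∀ X, (LtW.B LtW.N).mem G.κ G.r (LtW.C LtW.N) X → EoutW ≤ X 4 ^ 2 := by
  intro X hX
  have hB : LtW.B LtW.N = Bw32.toReal 60 := by
    show (tableT.entry 60 12 3 GIw RbIt tableT.steps.length).toReal 60 = _
    rw [(LtW_rowsValid hG).2]
  rw [hB] at hX
  have hz : ((1107665511110269268 : ℤ) : ℝ) / 2 ^ 60 ≤ X 4 := hX.2.2.2.2.1.1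
  have h0 : (0 : ℝ) ≤ ((1107665511110269268 : ℤ) : ℝ) / 2 ^ 60 := by positivity
  calc EoutW = (((1107665511110269268 : ℤ) : ℝ) / 2 ^ 60) ^ 2 := by norm_num [EoutW]
    _ ≤ X 4 ^ 2 := pow_le_pow_left₀ h0 hz 2

/-- The stage-3 reach certificate of the assembly interface, for every gate datum in the box.
[folklore] -/
def dataBox_transferStage {G : GateData} (hG : GIw.Mem 60 G) :
    ReachCertificate (thresholdCircuit G.ε G.σ G.ν G.μ G.r G.κ) (modeBall Rbt) G.δ T₃t
      {q | (LtW.B 0).mem G.κ G.r (LtW.C 0) q} (outputLoaded EoutW) :=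
  levelTableStage G (valid_of_memW hG) Rbt T₃t EoutW LtW _ (by norm_num [Rbt]) (LtW_rowsValid hG).1
    LtW_time.le (LtW_energy hG) (fun _ hq => hq) (LtW_exit hG)

/-- THE UNIFORM CERTIFICATE.  For every gate datum `G` in the box `GIw` (couplings within
relative `10⁻³` of the design point, `0 ≤ δ ≤ 1.001 δ₀`), every `G.δ`-approximate orbit of the
threshold circuit started in the level-`0` entry box loads the output mode to
`x s 4 ^ 2 ≥ EoutW ≈ 0.92304` at some time `s ≤ T₃t ≈ 0.20705`.
[cite: Tao2016AveragedNS, §5.5 Thm 5.3 (5.5)] -/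
theorem dataBox_transfer_reach {G : GateData} (hG : GIw.Mem 60 G) {p : Fin 5 → ℝ}
    (hp : (LtW.B 0).mem G.κ G.r (LtW.C 0) p) {x : ℝ → Fin 5 → ℝ} (hx0 : x 0 = p)
    (hcont : ContinuousOn x (Icc 0 T₃t))
    (hder : ∀ s ∈ Ico 0 T₃t, ∃ W : Fin 5 → ℝ, HasDerivWithinAt x W (Ici s) s ∧
      ‖W - thresholdCircuit G.ε G.σ G.ν G.μ G.r G.κ (x s)‖ ≤ G.δ) :
    ∃ s ∈ Icc 0 T₃t, EoutW ≤ x s 4 ^ 2 :=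
  levelTableStage_reach G (valid_of_memW hG) Rbt T₃t EoutW LtW
    {q | (LtW.B 0).mem G.κ G.r (LtW.C 0) q} (by norm_num [Rbt]) (LtW_rowsValid hG).1 LtW_time.le
    (by norm_num [T₃t]) (LtW_energy hG) (fun _ hq => hq) (LtW_exit hG) hp hx0 hcont hder

/-- The design point itself lies in the box. [folklore] -/
theorem Gt_memW : GIw.Mem 60 Gt :=
  ⟨by norm_num [DI.mem, GIw, Gt], by norm_num [DI.mem, GIw, Gt], by norm_num [DI.mem, GIw, Gt],
    by norm_num [DI.mem, GIw, Gt], by norm_num [DI.mem, GIw, Gt], by norm_num [DI.mem, GIw, Gt],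
    by norm_num [DI.mem, GIw, Gt]⟩

/-- An explicit state in the level-`0` entry box: the hypotheses of the certificates are not
vacuous (carrier `0.9701`, clock `0.2305`, trigger `C₀`, conduit `0.012673`, output `0.07487`;
energy `≈ 0.99999`, slaving residual `≈ −0.1027` at the design couplings). [folklore] -/
def pEntry : Fin 5 → ℝ :=
  ![9701 / 10000, 2305 / 10000, (470740496584930 : ℝ) / 2 ^ 60, 12673 / 1000000, 7487 / 100000]

/-- `pEntry` lies in the level-`0` entry box (with the design-point couplings). [folklore] -/
theorem pEntry_mem : (Lt.B 0).mem Gt.κ Gt.r (Lt.C 0) pEntry := by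
  rw [Lt_B_zero, Lt_C_zero]
  refine ⟨⟨?_, ?_⟩, ⟨?_, ?_⟩, ?_, ⟨?_, ?_⟩, ⟨?_, ?_⟩, ⟨?_, ?_⟩⟩
  all_goals
    simp only [LevelEntryD.toReal, Bc0, pEntry, Gt, slavingResidual, Ignition.energy_five, Fin.isValue,
      Matrix.cons_val_zero, Matrix.cons_val_one, Matrix.cons_val]
  all_goals norm_num

/-- Hence the entry set of the design-point certificate is nonempty. [folklore] -/
theorem Aint_nonempty : Aint.Nonempty := ⟨pEntry, pEntry_mem⟩

end ThresholdLevelTable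

end Literature.Analysis.FluidPDE.FluidComputer

end
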